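import Summits.QuantumFields.YangMills.Theorems.BalabanUVNodesN17RunRemAtOfShiftAnchorLevel
import Summits.QuantumFields.YangMills.Theorems.BalabanUVNodesK1RunwiseLettersOfBoxH
import Literature.MathematicalPhysics.QuantumFieldTheory.Balaban1983to89.Node00.Record13LettersOfThm1CCMWZB

/-!
# K1 BOOKKEEPING — NODE O's RUN ROWS READ β ONLY ON THE BOXES OF THEIR LEVEL: the four rows of record transfer between two history-dependent β's that AGREE on `]0, γ]^(k+1)`,
# hence from the K0 doors' HALF-WINDOW Z3 member to the K1 engine's WINDOW-EDITION member (director-ym №402 (R) «the K1 β-road socket takes the radius from the producer», P3 g84 spec (R1))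

TRACK A (YM-PLAN §2d), seat `pub-ymgap-dag-n24-c` (R134 N24 [B2] s2; gen 21, INTENT-4).  Key of record K1⁹ = stmt-QuantumFields-27364 (`--kind proof --supports 27364 --as helper`; count-neutral).
[I] = [Balaban1987RG1].

WHY.  The K1 engine v2 (✓p781730) displays NODE O's run rows `hrowsRF` and K0⁷'s β-box `h3` at EVERY small radius; director-ym №402 (R) ∕ P3's spec `ENGINE-v2-cofinal-socket.md` (R1)
replace both by ONE cofinal binder keyed at the K0 doors' member `θ₁₃ᶜᶜᴹᵂᶻᴮ(j; ½; a₀; ε₀, ε₂₉; B₃, B₃′, a₀, a₁; Efl, logz)` (window `½`), while the engine builds its witness at the WINDOW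
EDITION `θ₁₃ᶜᶜᴹᵂᶻᴮ(j′; γ; a₀; …)` with the SHRUNK window `γ ≤ ½` (the two letters `−(−β′)γ² ≤ 3`, `β′γ² ≤ ¾` force the shrink).  The two β's are NOT the same function — they agree
on the boxes `]0, γ]^(k+1)` (node00 `betaOfRecord₁₃_theta13OfThm1CCMWZB_eq_of_mem` + the letter census, `rfl` — k0's `K0V23Stub3Sockets.betaOfRecord₁₃_zbRegime_letterBlind`, restated inline here to stay off the Theses cone).  THIS FILE proves the
bookkeeping fact that NODE O's four rows of record — (i) the run-wise constant remainder `RunConstRemainder`, (iv) the run-wise partial-sum floor, (C) survivor continuity `SurvCont` (with its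
survivor set and the clamped forward run `FlowStep.Y ∕ clampPrefix`) — READ β ONLY ON THE BOXES OF THEIR OWN LEVEL, so they transfer from `β₂` to `β₁` at level `min γ₀ γ` whenever
`β₁ = β₂` on `]0, γ]^(k+1)`; and the Z3 instance the engine needs.  Pure bookkeeping over `FlowStep`'s carriers; nothing of Bałaban's asserted.

WHAT (0 `def`, 0 `sorry`; standard axioms):
§1 generic, `β₁ β₂ : HBeta` agreeing on the boxes of level `γ > 0`: `Y_congr` · `clampPrefix_congr` · `survivors_congr` · `survCont_congr` · `rgEqH_congr` · `runConstRemainder_congr` ·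
   `runPartialSumFloor_congr` · ★ `runRows_of_eqOn_box` (the four-row package, level `min γ₀ γ`).
§2 ★★ `runRows_theta13OfThm1CCMWZB_window_of_half` — at `N = 2`: the inline four-row package (K1⁹'s spelling) at the doors' half-window member with ANY letters `(j′, ε₀′, C₃, C₃′, c₁, Efl′, logz′)`
   ⟹ the same package at the window-edition member `(j; γ; a₀; ε₀, ε₂₉; B₃, B₃′, a₀, a₁; Efl, logz)` for `0 < γ ≤ ½` (same radius `a₀`, same threshold `ε₂₉`).

HONEST FRAMING.  Bookkeeping (row transport); NO estimate; nothing of Bałaban asserted; no row supplied; K0⁷ ∕ K1⁹ OPEN; NODE O not inhabited; N24 NOT discharged; COUNT 8∕27 · K 1∕4 UNMOVED;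
finite 𝕋⁴ at fixed ε, Bałaban AS PRINTED; NOT continuum ∕ OS ∕ Clay: the Yang–Mills mass gap is NOT proved by any of this.  No `sorry`, `def`, `instance`, `notation`.
-/

noncomputable section

open scoped BigOperators

namespace Summit.QuantumFields.YangMills.Theorems.K1RunRowsBoxCongr

open Literature.MathematicalPhysics.QuantumFieldTheory.Balaban1983to89
open Literature.MathematicalPhysics.QuantumFieldTheory.Balaban1983to89.FlowStep
open Literature.MathematicalPhysics.QuantumFieldTheory.Balaban1983to89.Node00
open Literature.MathematicalPhysics.QuantumFieldTheory.Balaban1983to89.T4Continuum (T4Family)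
open Summit.QuantumFields.YangMills.Theorems.BalabanUVNodesK2NamedJetsRunRemAt (RunConstRemainder SurvCont Survivors)
open Summit.QuantumFields.YangMills.BalabanUVNodes.N17RunRemAtOfShiftAnchorLevel (survCont_anti)
open Summit.QuantumFields.YangMills.Theorems.K1RunwiseLettersOfBoxH (prefixOf_mem_box_of_stepInInterval_le)

/-! ## §1. Two β's agreeing on the boxes of level `γ` -/

section Generic

variable {β₁ β₂ : HBeta} {γ : ℝ}

/-- The clamped forward runs of two β's agreeing on `]0, γ]^(k+1)` coincide (induction on the scale; every clamped prefix lies in the box). [cite: Balaban1987RG1, (0.20) p.256, §1 p.264 (bookkeeping)] -/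
theorem Y_congr (hγ : 0 < γ) (h : ∀ (k : ℕ) (v : Fin (k + 1) → ℝ), v ∈ Box γ k → β₁ k v = β₂ k v) (g₀ : ℝ) : ∀ k, Y β₁ γ k g₀ = Y β₂ γ k g₀ := by
  suffices H : ∀ k j, j ≤ k → Y β₁ γ j g₀ = Y β₂ γ j g₀ from fun k => H k k le_rfl
  intro k
  induction k with
  | zero => intro j hj; obtain rfl := Nat.le_zero.mp hj; rfl
  | succ k ih =>
    intro j hj
    rcases Nat.lt_or_eq_of_le hj with hlt | rfl
    · exact ih j (Nat.lt_succ_iff.mp hlt)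
    · have hcp : clampPrefix β₁ γ k g₀ = clampPrefix β₂ γ k g₀ := by
        funext i
        show gClamp γ (Y β₁ γ i g₀) = gClamp γ (Y β₂ γ i g₀)
        rw [ih i (Nat.lt_succ_iff.mp i.isLt)]
      rw [Y_succ', Y_succ', ih k le_rfl, hcp, h k _ (clampPrefix_mem_box hγ k g₀)]

/-- … hence the clamped prefixes coincide. [cite: Balaban1987RG1, (0.20) p.256 (bookkeeping)] -/
theorem clampPrefix_congr (hγ : 0 < γ) (h : ∀ (k : ℕ) (v : Fin (k + 1) → ℝ), v ∈ Box γ k → β₁ k v = β₂ k v) (k : ℕ) (g₀ : ℝ) :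
    clampPrefix β₁ γ k g₀ = clampPrefix β₂ γ k g₀ := by
  funext i
  show gClamp γ (Y β₁ γ i g₀) = gClamp γ (Y β₂ γ i g₀)
  rw [Y_congr hγ h g₀ i]

/-- … hence the survivor sets of level `γ` coincide. [cite: Balaban1987RG1, Thm 3 p.264 (bookkeeping)] -/
theorem survivors_congr (hγ : 0 < γ) (h : ∀ (k : ℕ) (v : Fin (k + 1) → ℝ), v ∈ Box γ k → β₁ k v = β₂ k v) (k : ℕ) : Survivors β₁ γ k = Survivors β₂ γ k := by
  ext x
  show (0 < x ∧ x ≤ γ ∧ ∀ j, j ≤ k → 1 / γ ^ 2 ≤ Y β₁ γ j x) ↔ (0 < x ∧ x ≤ γ ∧ ∀ j, j ≤ k → 1 / γ ^ 2 ≤ Y β₂ γ j x)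
  simp only [Y_congr hγ h x]

/-- **RUN-WISE (C) READS β ON THE BOXES ONLY**: survivor continuity of level `γ` transfers between β's agreeing on `]0, γ]^(k+1)`. [cite: Balaban1987RG1, §1 pp.263–264 (bookkeeping)] -/
theorem survCont_congr (hγ : 0 < γ) (h : ∀ (k : ℕ) (v : Fin (k + 1) → ℝ), v ∈ Box γ k → β₁ k v = β₂ k v) (hc : SurvCont β₂ γ) : SurvCont β₁ γ := fun k => by
  have e1 : (fun x : ℝ => β₁ k (clampPrefix β₁ γ k x)) = fun x : ℝ => β₂ k (clampPrefix β₂ γ k x) := by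
    funext x
    rw [clampPrefix_congr hγ h k x, h k _ (clampPrefix_mem_box hγ k x)]
  show ContinuousOn (fun x : ℝ => β₁ k (clampPrefix β₁ γ k x)) (Survivors β₁ γ k)
  rw [e1, survivors_congr hγ h k]
  exact hc k

/-- Along a `]0, γ]`-run, (0.20) for `β₁` is (0.20) for `β₂`. [cite: Balaban1987RG1, (0.20) p.256 (bookkeeping)] -/
theorem rgEqH_congr (h : ∀ (k : ℕ) (v : Fin (k + 1) → ℝ), v ∈ Box γ k → β₁ k v = β₂ k v) {n : ℕ} {gs : ℕ → ℝ} (hI : Step.InInterval γ n gs) :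
    RGEqH n β₁ gs ↔ RGEqH n β₂ gs := by
  refine forall₂_congr fun k hk => ?_
  rw [h k _ (prefixOf_mem_box_of_stepInInterval_le hI le_rfl hk.le)]

/-- **THE RUN-WISE CONSTANT REMAINDER READS β ON THE BOXES ONLY.** [cite: Balaban1987RG1, Thm 3 p.264, (5.10) p.293 (bookkeeping)] -/
theorem runConstRemainder_congr (h : ∀ (k : ℕ) (v : Fin (k + 1) → ℝ), v ∈ Box γ k → β₁ k v = β₂ k v) {b : ℕ → ℝ} {r : ℝ} (hR : RunConstRemainder β₂ b r γ) :
    RunConstRemainder β₁ b r γ := fun n gs hrg hI k hk => by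
  rw [h k _ (prefixOf_mem_box_of_stepInInterval_le hI le_rfl hk)]
  exact hR n gs ((rgEqH_congr h hI).mp hrg) hI k hk

/-- **THE RUN-WISE PARTIAL-SUM FLOOR READS β ON THE BOXES ONLY.** [cite: Balaban1987RG1, Thm 3 p.264 (bookkeeping)] -/
theorem runPartialSumFloor_congr (h : ∀ (k : ℕ) (v : Fin (k + 1) → ℝ), v ∈ Box γ k → β₁ k v = β₂ k v) {M : ℝ}
    (hP : ∀ (n : ℕ) (gs : ℕ → ℝ), RGEqH n β₂ gs → Step.InInterval γ n gs → ∀ k, k ≤ n → -M ≤ ∑ j ∈ Finset.Ico k n, β₂ j (prefixOf gs j)) :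
    ∀ (n : ℕ) (gs : ℕ → ℝ), RGEqH n β₁ gs → Step.InInterval γ n gs → ∀ k, k ≤ n → -M ≤ ∑ j ∈ Finset.Ico k n, β₁ j (prefixOf gs j) := by
  intro n gs hrg hI k hk
  have e : ∑ j ∈ Finset.Ico k n, β₁ j (prefixOf gs j) = ∑ j ∈ Finset.Ico k n, β₂ j (prefixOf gs j) :=
    Finset.sum_congr rfl fun j hj => h j _ (prefixOf_mem_box_of_stepInInterval_le hI le_rfl (Finset.mem_Ico.mp hj).2.le)
  rw [e]
  exact hP n gs ((rgEqH_congr h hI).mp hrg) hI k hk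

/-- **★ NODE O's FOUR RUN ROWS OF RECORD TRANSFER BETWEEN β's AGREEING ON THE BOXES OF LEVEL `γ`** (the package lands at level `min γ₀ γ`: rows (i)∕(iv) restrict to the smaller level
trivially, (C) by `survCont_anti`, then all three read β on `]0, min γ₀ γ]^(k+1) ⊆ ]0, γ]^(k+1)` only). [cite: Balaban1987RG1, Thm 3 p.264, (5.10) p.293, §1 pp.263–264 (bookkeeping)] -/
theorem runRows_of_eqOn_box (hγ : 0 < γ) (h : ∀ (k : ℕ) (v : Fin (k + 1) → ℝ), v ∈ Box γ k → β₁ k v = β₂ k v)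
    (H : ∃ (b : ℕ → ℝ) (r γ₀ M : ℝ), 0 < γ₀ ∧ RunConstRemainder β₂ b r γ₀ ∧
      (∀ (n : ℕ) (gs : ℕ → ℝ), RGEqH n β₂ gs → Step.InInterval γ₀ n gs → ∀ k, k ≤ n → -M ≤ ∑ j ∈ Finset.Ico k n, β₂ j (prefixOf gs j)) ∧ SurvCont β₂ γ₀) :
    ∃ (b : ℕ → ℝ) (r γ₀ M : ℝ), 0 < γ₀ ∧ RunConstRemainder β₁ b r γ₀ ∧
      (∀ (n : ℕ) (gs : ℕ → ℝ), RGEqH n β₁ gs → Step.InInterval γ₀ n gs → ∀ k, k ≤ n → -M ≤ ∑ j ∈ Finset.Ico k n, β₁ j (prefixOf gs j)) ∧ SurvCont β₁ γ₀ := by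
  obtain ⟨b, r, γ₀, M, hγ₀, hR, hP, hC⟩ := H
  have hγ' : 0 < min γ₀ γ := lt_min hγ₀ hγ
  have h' : ∀ (k : ℕ) (v : Fin (k + 1) → ℝ), v ∈ Box (min γ₀ γ) k → β₁ k v = β₂ k v := fun k v hv => h k v (box_mono (min_le_right γ₀ γ) k hv)
  refine ⟨b, r, min γ₀ γ, M, hγ', runConstRemainder_congr h' (hR.mono (min_le_left γ₀ γ)),
    runPartialSumFloor_congr h' (fun n gs hrg hI k hk => hP n gs hrg (fun i hi => ⟨(hI i hi).1, (hI i hi).2.trans (min_le_left γ₀ γ)⟩) k hk),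
    survCont_congr hγ' h' (survCont_anti hγ' (min_le_left γ₀ γ) hC)⟩

end Generic

/-! ## §2. ★★ At NODE 00's Z3 family (`N = 2`): the doors' half-window member ⟶ the engine's window-edition member -/

section Z3

variable {F : T4Family} {j j' : ℕ} {γ a₀ ε₀ ε₀' ε₂₉ B₃ B₃' C₃ C₃' a₁ c₁ : ℝ} {Efl logz Efl' logz' : B12.RunParams → ℕ → ℝ}

/-- **★★ NODE O's FOUR RUN ROWS AT THE DOORS' HALF-WINDOW Z3 MEMBER GIVE THE ROWS AT THE ENGINE's WINDOW-EDITION MEMBER** (`0 < γ ≤ ½`, same radius `a₀`, same threshold `ε₂₉`, every other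
letter free on both sides): the two β's agree on `]0, γ]^(k+1)` — node00's window transfer `betaOfRecord₁₃_theta13OfThm1CCMWZB_eq_of_mem` composed with the letter census
(`rfl`; k0's `K0V23Stub3Sockets.betaOfRecord₁₃_zbRegime_letterBlind`, inlined) — then §1.  Spelled in K1⁹'s inline currency (`RunConstRemainder` ∕ `SurvCont` unfold to it by `Iff.rfl`).  This is the
re-lettering step of director-ym №402 (R) ∕ P3 (R1) for the ROWS (the BOX re-letters by the census + `betaLowerH∕UpperH_theta13OfThm1CCMWZB_of_half`). [cite: Balaban1987RG1, Thm 3 p.264, (5.10) p.293, §1 pp.263–264, (1.20)–(1.22) p.264, (1.6) p.261, (2.9) p.266 (bookkeeping)] -/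
theorem runRows_theta13OfThm1CCMWZB_window_of_half (hγ0 : 0 < γ) (hγ : γ ≤ 1 / 2)
    (H : ∃ (b : ℕ → ℝ) (r γ₀ M : ℝ), 0 < γ₀ ∧
        (∀ (n : ℕ) (gs : ℕ → ℝ), RGEqH n (betaOfRecord₁₃ F 2 (theta13OfThm1CCMWZB F 2 j' (1 / 2) a₀ ε₀' ε₂₉ C₃ C₃' a₀ c₁ Efl' logz')) gs → Step.InInterval γ₀ n gs →
          ∀ k, k ≤ n → |betaOfRecord₁₃ F 2 (theta13OfThm1CCMWZB F 2 j' (1 / 2) a₀ ε₀' ε₂₉ C₃ C₃' a₀ c₁ Efl' logz') k (prefixOf gs k) - b k| ≤ r) ∧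
        (∀ (n : ℕ) (gs : ℕ → ℝ), RGEqH n (betaOfRecord₁₃ F 2 (theta13OfThm1CCMWZB F 2 j' (1 / 2) a₀ ε₀' ε₂₉ C₃ C₃' a₀ c₁ Efl' logz')) gs → Step.InInterval γ₀ n gs →
          ∀ k, k ≤ n → -M ≤ ∑ i ∈ Finset.Ico k n, betaOfRecord₁₃ F 2 (theta13OfThm1CCMWZB F 2 j' (1 / 2) a₀ ε₀' ε₂₉ C₃ C₃' a₀ c₁ Efl' logz') i (prefixOf gs i)) ∧
        ∀ k : ℕ, ContinuousOn (fun x : ℝ => betaOfRecord₁₃ F 2 (theta13OfThm1CCMWZB F 2 j' (1 / 2) a₀ ε₀' ε₂₉ C₃ C₃' a₀ c₁ Efl' logz') k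
            (clampPrefix (betaOfRecord₁₃ F 2 (theta13OfThm1CCMWZB F 2 j' (1 / 2) a₀ ε₀' ε₂₉ C₃ C₃' a₀ c₁ Efl' logz')) γ₀ k x))
          {x : ℝ | 0 < x ∧ x ≤ γ₀ ∧ ∀ i, i ≤ k → 1 / γ₀ ^ 2 ≤ Y (betaOfRecord₁₃ F 2 (theta13OfThm1CCMWZB F 2 j' (1 / 2) a₀ ε₀' ε₂₉ C₃ C₃' a₀ c₁ Efl' logz')) γ₀ i x}) :
    ∃ (b : ℕ → ℝ) (r γ₀ M : ℝ), 0 < γ₀ ∧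
        (∀ (n : ℕ) (gs : ℕ → ℝ), RGEqH n (betaOfRecord₁₃ F 2 (theta13OfThm1CCMWZB F 2 j γ a₀ ε₀ ε₂₉ B₃ B₃' a₀ a₁ Efl logz)) gs → Step.InInterval γ₀ n gs →
          ∀ k, k ≤ n → |betaOfRecord₁₃ F 2 (theta13OfThm1CCMWZB F 2 j γ a₀ ε₀ ε₂₉ B₃ B₃' a₀ a₁ Efl logz) k (prefixOf gs k) - b k| ≤ r) ∧
        (∀ (n : ℕ) (gs : ℕ → ℝ), RGEqH n (betaOfRecord₁₃ F 2 (theta13OfThm1CCMWZB F 2 j γ a₀ ε₀ ε₂₉ B₃ B₃' a₀ a₁ Efl logz)) gs → Step.InInterval γ₀ n gs →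
          ∀ k, k ≤ n → -M ≤ ∑ i ∈ Finset.Ico k n, betaOfRecord₁₃ F 2 (theta13OfThm1CCMWZB F 2 j γ a₀ ε₀ ε₂₉ B₃ B₃' a₀ a₁ Efl logz) i (prefixOf gs i)) ∧
        ∀ k : ℕ, ContinuousOn (fun x : ℝ => betaOfRecord₁₃ F 2 (theta13OfThm1CCMWZB F 2 j γ a₀ ε₀ ε₂₉ B₃ B₃' a₀ a₁ Efl logz) k
            (clampPrefix (betaOfRecord₁₃ F 2 (theta13OfThm1CCMWZB F 2 j γ a₀ ε₀ ε₂₉ B₃ B₃' a₀ a₁ Efl logz)) γ₀ k x))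
          {x : ℝ | 0 < x ∧ x ≤ γ₀ ∧ ∀ i, i ≤ k → 1 / γ₀ ^ 2 ≤ Y (betaOfRecord₁₃ F 2 (theta13OfThm1CCMWZB F 2 j γ a₀ ε₀ ε₂₉ B₃ B₃' a₀ a₁ Efl logz)) γ₀ i x} :=
  runRows_of_eqOn_box (β₂ := betaOfRecord₁₃ F 2 (theta13OfThm1CCMWZB F 2 j' (1 / 2) a₀ ε₀' ε₂₉ C₃ C₃' a₀ c₁ Efl' logz')) hγ0
    (fun k v hv => by
      -- the window transfer on the box, then the letter census (β₁₃ at the half-window Z3 member reads `(F; a₀, ε₂₉)` only: `rfl`, k0's `K0V23Stub3Sockets.betaOfRecord₁₃_zbRegime_letterBlind`)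
      rw [betaOfRecord₁₃_theta13OfThm1CCMWZB_eq_of_mem hγ hv]
      exact congrFun (congrFun (rfl : betaOfRecord₁₃ F 2 (theta13OfThm1CCMWZB F 2 j (1 / 2) a₀ ε₀ ε₂₉ B₃ B₃' a₀ a₁ Efl logz) =
        betaOfRecord₁₃ F 2 (theta13OfThm1CCMWZB F 2 j' (1 / 2) a₀ ε₀' ε₂₉ C₃ C₃' a₀ c₁ Efl' logz')) k) v)
    H

end Z3

end Summit.QuantumFields.YangMills.Theorems.K1RunRowsBoxCongr

end
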